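import Summits.BirchSwinnertonDyer.BirchSwinnertonDyer.Theorems.AlignedTransportAtTwoMainConjectureOfRankZeroBSDAtTwoHalfDescentLayerIndexGrowthFiniteTwistRelaxedPlaces
import HarnessLib

/-!
# Route `AlignedTransportAtTwo`, crux C2 `MainConjectureOfRankZeroBSDAtTwo` (stmt-BirchSwinnertonDyer-22298):
# THE RELAXATION DEFECT BY LOCAL NUMBERS — `[Sel♯⁽ᵐ⁾_n : Sel_{p^∞}(E/K_n)] ≤ ∏_{v ∈ S} #ker(H¹(K_vK_n, E) → H¹(K_vK_m, E))^{N_v}`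
# for any finite set `S` of finite places of `K` outside which the FINITE-STEP local kernel vanishes (automatic at the places that split completely from `K_n`
# to `K_m` and, over the base, at the good places away from `p`), `N_v` = the number of double cosets `D_v \ Γ_K / Gal(K̄/K_n)` (places of `K_n` above `v`):
# Greenberg's proof of Lemma 3.5 run on the relaxed group `Sel♯` of gens 58–59 instead of `A_n`, with the finite-step local kernels instead of `𝒦_{v,n}[p^∞]`

HONEST FRAMING (cell `bsd-f1-sign2`, WIDTH-5 attached prover seat `bsd-line-att-p5` gen 59 on line `birth` of the lead `bsd-line-att-p2`;
`--supports` stmt-BirchSwinnertonDyer-22298, closes nothing; BSD is NOT proved by any of this; the crux C2, its verdict «blocked-on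
`Rank1Residual.GreenbergMuConjectureIrreducible`» and every registered stub (P / T / Kμ / LimDoor / MuIneqʳ / PFμ⁺) are untouched). THEOREMS ONLY — no `def`,
no instance, no named fact, no `sorry`. Sequel of `…GrowthFiniteTwistRelaxed` (local form of the relaxed condition; vanishing of the finite-step local kernel at the
archimedean and at the split places) and `…GrowthFiniteTwistRelaxedPlaces` (level `0`: vanishing at the good places away from `p`), modelled on the tree's
`WeierstrassCurve.mem_selmerLayer_of_forall_localResOver_conjH1_eq_zero` / `finite_kerG_and_card_le_of_localKernelBounds` (Greenberg's Lemma 3.5 for `A_n/Sel_n = ker g_n`).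

THE POINT. The evaluation map `Φ : Sel♯⁽ᵐ⁾_n → ∏_{v ∈ S, ρ ∈ R_v} H¹(Gal(K̄_v/K_vK_n), E(K̄_v))`, `c ↦ (loc_v(conj_ρ c))`, takes values in the FINITE-STEP local kernels
`ker(res : H¹(K_vK_n, E) → H¹(K_vK_m, E))` (`mem_comap_resOfLe_selmerLayer_iff`) and ★★★ **`ker Φ ⊆ Sel_{p^∞}(E/K_n)`** whenever the finite-step local kernel vanishes at the
finite places outside `S` and `R_v` represents the double cosets `D_v \ Γ_K / Gal(K̄/K_n)` for `v ∈ S` (`mem_selmerLayer_of_mem_comap_of_forall_eq_zero`: at `σ = δ|ρτ` one has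
`loc_v(conj_σ c) = conj_δ(loc_v(conj_ρ c))`, tree `localResOver_conjH1_resGal`; `Gal(K̄/K_n)` acts trivially). Hence ★★★ **`Sel♯⁽ᵐ⁾_n / Sel_n` is finite of order
`≤ ∏_{v ∈ S} C_v^{#R_v}`** when the local kernels at `v ∈ S` are finite of order `≤ C_v` (`finite_and_relIndex_le_of_localKernelBounds`) — the relaxation defect of gens 58–59 bounded by
LOCAL NUMBERS of the layer `K_m/K_n` ALONE (not the whole tower's `𝒦_{v,n}`), exactly Kramer's shape `#(i_v⁻¹(S′_v)/S_v) = p^{i_v}` (1981, eq. (11), one quadratic layer, `E[2]`-level).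
No hypothesis on `p`, `κ`, the reduction type or the rank; `S`, `C`, `R` are displayed data. Over the base (`n = 0`) `S` may be taken `⊇ {v ∣ p} ∪ {bad v} ∩ {non-split}`
(`…RelaxedPlaces`), and with `p = 2`, `m = 1`, `W′ = W^{(d)}` this bounds `#M_1(W) = #Sel♯_0(W^{(d)})` (gen 58) by `#Sel_{2^∞}(W^{(d)}/K) · ∏_{v ∈ S} C_v^{N_v}`.
What is NOT claimed: the local orders `C_v` are NOT computed (Kramer's Props. 1–6 / Greenberg's Lemmas 3.3–3.4 give them in print); nothing numerical; C2 untouched.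
Memo `Cruxes/MainConjectureOfRankZeroBSDAtTwo/RELAXED-PREIMAGE-att-p5-g59.md`.

References: R. Greenberg, LNM 1716 (1999), §3 Lemma 3.5 (proof, p. 90), pp. 85–90, §2 p. 71 [GreenbergLNM1716]; K. Kramer, Trans. AMS 264 (1981), §2 Props. 1–7, eq. (11)
[Kramer1981]; J.-P. Serre, *Galois Cohomology*, I.§2.5–2.6, II.§1.1 [SerreGaloisCohomology1997]; B. Mazur, Invent. Math. 18 (1972) §6 [Mazur1972].
-/

set_option linter.dupNamespace false
set_option autoImplicit false

noncomputable section

open scoped Classical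

universe u

namespace Summit.BirchSwinnertonDyer.BirchSwinnertonDyer.Theorems.AlignedTransportAtTwoHalfDescentLayerIndexGrowthFiniteTwistRelaxedIndex

open WeierstrassCurve Literature.NumberTheory.EllipticCurves NumberField IsDedekindDomain
  Summit.BirchSwinnertonDyer.BirchSwinnertonDyer.Theorems.AlignedTransportAtTwoHalfDescentLayerIndexGrowthFiniteTwistRelaxed
  Summit.BirchSwinnertonDyer.BirchSwinnertonDyer.Theorems.AlignedTransportAtTwoHalfDescentLayerIndexGrowthFiniteTwistRelaxedPlaces

section Index

variable {K : Type u} [Field K] [NumberField K] (W : WeierstrassCurve K) {p : ℕ} [hp : Fact p.Prime] (κ : ZpExtension K p)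

/-- ★★★ **VANISHING AT REPRESENTATIVES FORCES THE HONEST CONDITIONS EVERYWHERE (relaxed version).** Let `c ∈ Sel♯⁽ᵐ⁾_n = res⁻¹_{n→m}(Sel_{p^∞}(E/K_m))`. Suppose the finite-step
local kernel `ker(H¹(K_vK_n, E) → H¹(K_vK_m, E))` vanishes at the finite places `v ∉ S`, and for `v ∈ S` every `σ ∈ Γ_K` lies in a double coset `D_v ρ Gal(K̄/K_n)` with `ρ ∈ R_v`.
If `loc_v(conj_ρ c) = 0` for all `v ∈ S`, `ρ ∈ R_v`, then `c ∈ Sel_{p^∞}(E/K_n)`. (Greenberg's p. 90 argument on `Sel♯ ⊆ A_n`; no `p`-primary parts needed.)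
[cite: GreenbergLNM1716, §3 Lemma 3.5 (proof, p. 90), §2 p. 71] [cite: SerreGaloisCohomology1997, II.§1.1] -/
theorem mem_selmerLayer_of_mem_comap_of_forall_eq_zero {n m : ℕ} (hnm : n ≤ m) (S : Finset (HeightOneSpectrum (𝓞 K)))
    (h0 : ∀ v ∉ S, (Literature.NumberTheory.EllipticCurves.resOfLe (localPoints W (v.adicCompletion K))
      (localSubgroup_layer_antitone κ (v.adicCompletion K) hnm)).ker = ⊥)
    (R : HeightOneSpectrum (𝓞 K) → Finset (Field.absoluteGaloisGroup K))
    (hR : ∀ v ∈ S, ∀ σ : Field.absoluteGaloisGroup K, ∃ ρ ∈ R v,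
      ∃ δ : Field.absoluteGaloisGroup (v.adicCompletion K), ∃ τ ∈ κ.layerSubgroup n, σ = resGal (K := K) (v.adicCompletion K) δ * ρ * τ)
    {c : W.subgroupH1 p (κ.layerSubgroup n)} (hc : c ∈ (W.selmerLayer κ m).comap (W.resOfLe p (κ.layerSubgroup_antitone hnm)))
    (hzero : ∀ v ∈ S, ∀ ρ ∈ R v, W.localResOver p (κ.layerSubgroup n) (v.adicCompletion K) (W.conjH1 p (κ.layerSubgroup n) ρ c) = 0) :
    c ∈ W.selmerLayer κ n := by
  change c ∈ W.selmerGroupOver p (κ.layerSubgroup n)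
  rw [W.mem_selmerGroupOver_iff p]
  refine ⟨fun v σ ↦ ?_, fun w σ ↦ conjH1_mem_localKerOver_infinitePlace_of_mem_comap W κ hnm hc w σ⟩
  rw [mem_localKerOver_iff]
  by_cases hv : v ∈ S
  · obtain ⟨ρ, hρ, δ, τ, hτ, rfl⟩ := hR v hv σ
    rw [W.conjH1_mul_holds p (κ.layerSubgroup n) (resGal (K := K) (v.adicCompletion K) δ * ρ) τ, AddMonoidHom.comp_apply,
      W.conjH1_of_mem_holds p (κ.layerSubgroup n) hτ, AddMonoidHom.id_apply,
      W.conjH1_mul_holds p (κ.layerSubgroup n) (resGal (K := K) (v.adicCompletion K) δ) ρ, AddMonoidHom.comp_apply,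
      localResOver_conjH1_resGal, hzero v hv ρ hρ, map_zero]
  · have hmem := ((mem_comap_resOfLe_selmerLayer_iff W κ hnm c).mp hc).1 v σ
    rw [h0 v hv, AddSubgroup.mem_bot] at hmem
    exact hmem

/-- ★★★ **THE RELAXATION DEFECT BOUNDED BY LOCAL NUMBERS.** If the finite-step local kernel `ker(H¹(K_vK_n, E) → H¹(K_vK_m, E))` vanishes at the finite `v ∉ S`, is finite of order
`≤ C_v` at `v ∈ S`, and `R_v` (`v ∈ S`) represents the double cosets `D_v \ Γ_K / Gal(K̄/K_n)`, then **`Sel♯⁽ᵐ⁾_n / Sel_{p^∞}(E/K_n)` is finite and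
`[Sel♯⁽ᵐ⁾_n : Sel_{p^∞}(E/K_n)] ≤ ∏_{v ∈ S} C_v^{#R_v}`**. [cite: GreenbergLNM1716, §3 Lemma 3.5 (proof, p. 90)] [cite: Kramer1981, Prop. 7, eq. (11)] -/
theorem finite_and_relIndex_le_of_localKernelBounds {n m : ℕ} (hnm : n ≤ m) (S : Finset (HeightOneSpectrum (𝓞 K))) (C : HeightOneSpectrum (𝓞 K) → ℕ)
    (h0 : ∀ v ∉ S, (Literature.NumberTheory.EllipticCurves.resOfLe (localPoints W (v.adicCompletion K))
      (localSubgroup_layer_antitone κ (v.adicCompletion K) hnm)).ker = ⊥)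
    (hC : ∀ v ∈ S, Finite (Literature.NumberTheory.EllipticCurves.resOfLe (localPoints W (v.adicCompletion K))
        (localSubgroup_layer_antitone κ (v.adicCompletion K) hnm)).ker ∧
      Nat.card (Literature.NumberTheory.EllipticCurves.resOfLe (localPoints W (v.adicCompletion K))
        (localSubgroup_layer_antitone κ (v.adicCompletion K) hnm)).ker ≤ C v)
    (R : HeightOneSpectrum (𝓞 K) → Finset (Field.absoluteGaloisGroup K))
    (hR : ∀ v ∈ S, ∀ σ : Field.absoluteGaloisGroup K, ∃ ρ ∈ R v,
      ∃ δ : Field.absoluteGaloisGroup (v.adicCompletion K), ∃ τ ∈ κ.layerSubgroup n, σ = resGal (K := K) (v.adicCompletion K) δ * ρ * τ) :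
    Finite (↥((W.selmerLayer κ m).comap (W.resOfLe p (κ.layerSubgroup_antitone hnm))) ⧸
        (W.selmerLayer κ n).addSubgroupOf ((W.selmerLayer κ m).comap (W.resOfLe p (κ.layerSubgroup_antitone hnm)))) ∧
      (W.selmerLayer κ n).relIndex ((W.selmerLayer κ m).comap (W.resOfLe p (κ.layerSubgroup_antitone hnm))) ≤ ∏ v ∈ S, C v ^ (R v).card := by
  set A := (W.selmerLayer κ m).comap (W.resOfLe p (κ.layerSubgroup_antitone hnm)) with hA
  -- the index set `I = {(v, ρ) : v ∈ S, ρ ∈ R_v}` of the evaluation map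
  set I : Finset ((_ : HeightOneSpectrum (𝓞 K)) × Field.absoluteGaloisGroup K) := S.sigma fun v ↦ R v with hI
  have hIv : ∀ i : ↥I, i.1.1 ∈ S := fun i ↦ (Finset.mem_sigma.mp i.2).1
  -- the evaluation map `Φ c = (loc_v (conj_ρ c))_{(v, ρ) ∈ I}`
  let Φ : ↥A →+ (Π i : ↥I, discreteH1 (localSubgroup (κ.layerSubgroup n) (i.1.1.adicCompletion K)) (localPoints W (i.1.1.adicCompletion K))) :=
    AddMonoidHom.pi fun i ↦
      ((W.localResOver p (κ.layerSubgroup n) (i.1.1.adicCompletion K)).comp (W.conjH1 p (κ.layerSubgroup n) i.1.2)).comp A.subtype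
  have hΦ : ∀ (y : ↥A) (i : ↥I), Φ y i =
      W.localResOver p (κ.layerSubgroup n) (i.1.1.adicCompletion K) (W.conjH1 p (κ.layerSubgroup n) i.1.2 (y : W.subgroupH1 p _)) :=
    fun y i ↦ rfl
  -- `ker Φ ⊆ Sel_n`
  have hker : Φ.ker ≤ (W.selmerLayer κ n).addSubgroupOf A := by
    intro y hy
    rw [AddSubgroup.mem_addSubgroupOf]
    refine mem_selmerLayer_of_mem_comap_of_forall_eq_zero W κ hnm S h0 R hR y.2 fun v hv ρ hρ ↦ ?_
    have := congrFun ((AddMonoidHom.mem_ker).mp hy) ⟨⟨v, ρ⟩, Finset.mem_sigma.mpr ⟨hv, hρ⟩⟩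
    rw [hΦ] at this
    exact this
  -- the values of `Φ` lie in the finite-step local kernels
  have hval : ∀ (y : ↥A) (i : ↥I), Φ y i ∈ (Literature.NumberTheory.EllipticCurves.resOfLe (localPoints W (i.1.1.adicCompletion K))
      (localSubgroup_layer_antitone κ (i.1.1.adicCompletion K) hnm)).ker := by
    intro y i
    rw [hΦ]
    exact ((mem_comap_resOfLe_selmerLayer_iff W κ hnm (y : W.subgroupH1 p _)).mp y.2).1 _ _
  -- finiteness and counting
  haveI hfin : ∀ i : ↥I, Finite (Literature.NumberTheory.EllipticCurves.resOfLe (localPoints W (i.1.1.adicCompletion K))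
      (localSubgroup_layer_antitone κ (i.1.1.adicCompletion K) hnm)).ker := fun i ↦ (hC _ (hIv i)).1
  let g : Φ.range → Π i : ↥I, ↥(Literature.NumberTheory.EllipticCurves.resOfLe (localPoints W (i.1.1.adicCompletion K))
      (localSubgroup_layer_antitone κ (i.1.1.adicCompletion K) hnm)).ker :=
    fun x i ↦ ⟨x.1 i, by obtain ⟨y, hy⟩ := x.2; rw [← hy]; exact hval y i⟩
  have hg : Function.Injective g := by
    rintro ⟨x, hx⟩ ⟨x', hx'⟩ h
    refine Subtype.ext (funext fun i ↦ ?_)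
    have := congrFun h i
    simpa [g] using this
  haveI : Finite Φ.range := Finite.of_injective g hg
  have hcard_range : Nat.card Φ.range ≤ ∏ i : ↥I, C i.1.1 :=
    calc Nat.card Φ.range
        ≤ Nat.card (Π i : ↥I, ↥(Literature.NumberTheory.EllipticCurves.resOfLe (localPoints W (i.1.1.adicCompletion K))
            (localSubgroup_layer_antitone κ (i.1.1.adicCompletion K) hnm)).ker) := Nat.card_le_card_of_injective g hg
      _ = ∏ i : ↥I, Nat.card ↥(Literature.NumberTheory.EllipticCurves.resOfLe (localPoints W (i.1.1.adicCompletion K))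
            (localSubgroup_layer_antitone κ (i.1.1.adicCompletion K) hnm)).ker := Nat.card_pi
      _ ≤ ∏ i : ↥I, C i.1.1 := Finset.prod_le_prod (fun i _ ↦ Nat.zero_le _) fun i _ ↦ (hC _ (hIv i)).2
  -- `A ⧸ ker Φ ↠ A ⧸ Sel_n`
  let π : ↥A ⧸ Φ.ker →+ ↥A ⧸ (W.selmerLayer κ n).addSubgroupOf A :=
    QuotientAddGroup.map Φ.ker ((W.selmerLayer κ n).addSubgroupOf A) (AddMonoidHom.id _) (by rwa [AddSubgroup.comap_id])
  have hπ : Function.Surjective π := by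
    intro q
    induction q using QuotientAddGroup.induction_on with
    | H a => exact ⟨QuotientAddGroup.mk a, rfl⟩
  haveI : Finite (↥A ⧸ Φ.ker) := Finite.of_equiv _ (QuotientAddGroup.quotientKerEquivRange Φ).toEquiv.symm
  have hcard_ker : Nat.card (↥A ⧸ Φ.ker) = Nat.card Φ.range := Nat.card_congr (QuotientAddGroup.quotientKerEquivRange Φ).toEquiv
  refine ⟨Finite.of_surjective π hπ, ?_⟩
  calc (W.selmerLayer κ n).relIndex A = Nat.card (↥A ⧸ (W.selmerLayer κ n).addSubgroupOf A) := rfl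
    _ ≤ Nat.card (↥A ⧸ Φ.ker) := Nat.card_le_card_of_surjective π hπ
    _ = Nat.card Φ.range := hcard_ker
    _ ≤ ∏ i : ↥I, C i.1.1 := hcard_range
    _ = ∏ i ∈ I, C i.1 := Finset.prod_coe_sort I (fun i ↦ C i.1)
    _ = ∏ v ∈ S, ∏ ρ ∈ R v, C v := Finset.prod_sigma S (fun v ↦ R v) (fun i ↦ C i.1)
    _ = ∏ v ∈ S, C v ^ (R v).card := Finset.prod_congr rfl fun v _ ↦ Finset.prod_const (C v)

/-- ★★★ Order form: **`#Sel♯⁽ᵐ⁾_n ≤ #Sel_{p^∞}(E/K_n) · ∏_{v ∈ S} C_v^{#R_v}`** whenever `Sel_{p^∞}(E/K_n)` is finite (same local data). With gen 58's `#M_{n+1}(W) = #Sel♯_n(W′)`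
(`p = 2`, `m = n+1`, `W′` the twist) this is the seed's signed object bounded by the HONEST Selmer group of the twist times LOCAL NUMBERS of the single layer `K_{n+1}/K_n`.
[cite: GreenbergLNM1716, §3 Lemma 3.5 (proof, p. 90)] [cite: Kramer1981, Thm. 1, Prop. 7, eq. (11)] -/
theorem natCard_comap_le_of_localKernelBounds {n m : ℕ} (hnm : n ≤ m) (S : Finset (HeightOneSpectrum (𝓞 K))) (C : HeightOneSpectrum (𝓞 K) → ℕ)
    (h0 : ∀ v ∉ S, (Literature.NumberTheory.EllipticCurves.resOfLe (localPoints W (v.adicCompletion K))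
      (localSubgroup_layer_antitone κ (v.adicCompletion K) hnm)).ker = ⊥)
    (hC : ∀ v ∈ S, Finite (Literature.NumberTheory.EllipticCurves.resOfLe (localPoints W (v.adicCompletion K))
        (localSubgroup_layer_antitone κ (v.adicCompletion K) hnm)).ker ∧
      Nat.card (Literature.NumberTheory.EllipticCurves.resOfLe (localPoints W (v.adicCompletion K))
        (localSubgroup_layer_antitone κ (v.adicCompletion K) hnm)).ker ≤ C v)
    (R : HeightOneSpectrum (𝓞 K) → Finset (Field.absoluteGaloisGroup K))
    (hR : ∀ v ∈ S, ∀ σ : Field.absoluteGaloisGroup K, ∃ ρ ∈ R v,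
      ∃ δ : Field.absoluteGaloisGroup (v.adicCompletion K), ∃ τ ∈ κ.layerSubgroup n, σ = resGal (K := K) (v.adicCompletion K) δ * ρ * τ)
    [Finite (W.selmerLayer κ n)] :
    Finite ((W.selmerLayer κ m).comap (W.resOfLe p (κ.layerSubgroup_antitone hnm))) ∧
      Nat.card ((W.selmerLayer κ m).comap (W.resOfLe p (κ.layerSubgroup_antitone hnm))) ≤ Nat.card (W.selmerLayer κ n) * ∏ v ∈ S, C v ^ (R v).card := by
  obtain ⟨hfinq, hle⟩ := finite_and_relIndex_le_of_localKernelBounds W κ hnm S C h0 hC R hR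
  have hmul := natCard_comap_resOfLe_selmerLayer_eq_mul W κ hnm
  have hidx : (W.selmerLayer κ n).relIndex ((W.selmerLayer κ m).comap (W.resOfLe p (κ.layerSubgroup_antitone hnm))) ≠ 0 := by
    haveI := hfinq
    exact Nat.card_pos.ne'
  refine ⟨Nat.finite_of_card_ne_zero (by rw [hmul]; exact mul_ne_zero Nat.card_pos.ne' hidx), ?_⟩
  rw [hmul]
  exact Nat.mul_le_mul_left _ hle

end Index

/-! ## Over the base: `S ⊇` the non-split places among `{v ∣ p} ∪ {bad v}` suffices -/

section LevelZero

variable {K : Type u} [Field K] [NumberField K] (W : WeierstrassCurve K) [W.IsElliptic] {p : ℕ} [hp : Fact p.Prime] (κ : ZpExtension K p)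

/-- ★★ **OVER THE BASE the vanishing hypothesis holds off any `S` containing the places that divide `p` or are bad AND do not split completely from `K` to `K_m`**: at the other finite
places the finite-step local kernel vanishes (split: equal local subgroups; good `v ∤ p`: Greenberg's Lemma 3.3 at level `0`). [cite: GreenbergLNM1716, §3 Lemma 3.3, p. 90] -/
theorem ker_resOfLe_local_zero_eq_bot_of_not_mem (m : ℕ) (S : Finset (HeightOneSpectrum (𝓞 K)))
    (hS : ∀ v : HeightOneSpectrum (𝓞 K), ((p : 𝓞 K) ∈ v.asIdeal ∨ ¬ W.HasGoodReductionAt v) →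
      ¬ (localSubgroup (κ.layerSubgroup 0) (v.adicCompletion K) ≤ localSubgroup (κ.layerSubgroup m) (v.adicCompletion K)) → v ∈ S) :
    ∀ v ∉ S, (Literature.NumberTheory.EllipticCurves.resOfLe (localPoints W (v.adicCompletion K))
      (localSubgroup_layer_antitone κ (v.adicCompletion K) (Nat.zero_le m))).ker = ⊥ := by
  intro v hv
  by_cases hsplit : localSubgroup (κ.layerSubgroup 0) (v.adicCompletion K) ≤ localSubgroup (κ.layerSubgroup m) (v.adicCompletion K)
  · rw [AddMonoidHom.ker_eq_bot_iff]
    exact resOfLe_injective_of_ge (localPoints W (v.adicCompletion K)) (localSubgroup_layer_antitone κ (v.adicCompletion K) (Nat.zero_le m)) hsplit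
  · by_cases hpv : (p : 𝓞 K) ∈ v.asIdeal
    · exact absurd (hS v (Or.inl hpv) hsplit) hv
    · by_cases hgood : W.HasGoodReductionAt v
      · exact ker_resOfLe_local_zero_eq_bot_of_hasGoodReductionAt W κ m v hpv hgood
      · exact absurd (hS v (Or.inr hgood) hsplit) hv

/-- ★★★ **`[Sel♯⁽ᵐ⁾_0 : Sel_{p^∞}(E/K)] ≤ ∏_{v ∈ S} C_v^{#R_v}`** for any finite `S` containing the non-split places among `{v ∣ p} ∪ {bad v}`, local kernel bounds `C_v` and double-coset
representatives `R_v` on `S` (at level `0`, `Gal(K̄/K_0) = Γ_K`, so `R_v = {1}` works: `N_v = 1`). The relaxed group over the base exceeds the Selmer group by LOCAL NUMBERS at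
finitely many places. [cite: GreenbergLNM1716, §3 Lemmas 3.3, 3.5] [cite: Kramer1981, Thm. 1, Props. 1–7] -/
theorem finite_and_relIndex_zero_le_of_localKernelBounds (m : ℕ) (S : Finset (HeightOneSpectrum (𝓞 K))) (C : HeightOneSpectrum (𝓞 K) → ℕ)
    (hS : ∀ v : HeightOneSpectrum (𝓞 K), ((p : 𝓞 K) ∈ v.asIdeal ∨ ¬ W.HasGoodReductionAt v) →
      ¬ (localSubgroup (κ.layerSubgroup 0) (v.adicCompletion K) ≤ localSubgroup (κ.layerSubgroup m) (v.adicCompletion K)) → v ∈ S)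
    (hC : ∀ v ∈ S, Finite (Literature.NumberTheory.EllipticCurves.resOfLe (localPoints W (v.adicCompletion K))
        (localSubgroup_layer_antitone κ (v.adicCompletion K) (Nat.zero_le m))).ker ∧
      Nat.card (Literature.NumberTheory.EllipticCurves.resOfLe (localPoints W (v.adicCompletion K))
        (localSubgroup_layer_antitone κ (v.adicCompletion K) (Nat.zero_le m))).ker ≤ C v) :
    Finite (↥((W.selmerLayer κ m).comap (W.resOfLe p (κ.layerSubgroup_antitone (Nat.zero_le m)))) ⧸
        (W.selmerLayer κ 0).addSubgroupOf ((W.selmerLayer κ m).comap (W.resOfLe p (κ.layerSubgroup_antitone (Nat.zero_le m))))) ∧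
      (W.selmerLayer κ 0).relIndex ((W.selmerLayer κ m).comap (W.resOfLe p (κ.layerSubgroup_antitone (Nat.zero_le m)))) ≤ ∏ v ∈ S, C v := by
  have hR : ∀ v ∈ S, ∀ σ : Field.absoluteGaloisGroup K, ∃ ρ ∈ ({1} : Finset (Field.absoluteGaloisGroup K)),
      ∃ δ : Field.absoluteGaloisGroup (v.adicCompletion K), ∃ τ ∈ κ.layerSubgroup 0, σ = resGal (K := K) (v.adicCompletion K) δ * ρ * τ := by
    intro v _ σ
    refine ⟨1, Finset.mem_singleton_self 1, 1, σ, ?_, by rw [map_one, one_mul, one_mul]⟩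
    rw [ZpExtension.layerSubgroup_zero]
    exact Subgroup.mem_top σ
  obtain ⟨hfin, hle⟩ := finite_and_relIndex_le_of_localKernelBounds W κ (Nat.zero_le m) S C (ker_resOfLe_local_zero_eq_bot_of_not_mem W κ m S hS) hC
    (fun _ ↦ {1}) hR
  refine ⟨hfin, hle.trans (le_of_eq (Finset.prod_congr rfl fun v _ ↦ ?_))⟩
  rw [Finset.card_singleton, pow_one]

end LevelZero

end Summit.BirchSwinnertonDyer.BirchSwinnertonDyer.Theorems.AlignedTransportAtTwoHalfDescentLayerIndexGrowthFiniteTwistRelaxedIndex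

end
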